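import Literature.AlgebraicGeometry.Frobenioids.Endomorphisms
import Literature.AlgebraicGeometry.Frobenioids.ElementaryIsFrobenioid
import Mathlib.CategoryTheory.SingleObj
import Mathlib.Data.NNRat.Order
import Mathlib.Algebra.Order.Field.Basic
import HarnessLib

/-!
# Frobenioids I, Proposition 1.12 (ii)–(iv): an elementary Frobenioid in which a sub-automorphism
# is not isometric

Mochizuki, *The geometry of Frobenioids I: the general theory*, Kyushu J. Math. **62** (2008)
293–400, §1, Proposition 1.12 (ii)–(iv), kurims text p. 39 [cite: MochizukiFrdI2008, Prop. 1.12].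
The printed necessity in (ii) ("a sub-automorphism is an isometric linear endomorphism …
immediate from Remark 1.1.1"), the sufficiency in (iii) and assertion (iv) are typed as statements
in `Endomorphisms.lean`. This file records, kernel-checked, the example announced there:

* `D` = the one-object category of the group `ℤ` (all arrows invertible, so `D` is connected and
  totally epimorphic); `Φ(pt) = (ℚ_{≥0}, +)` (a pre-divisorial monoid: integral, saturated, of
  characteristic type) on which the generator acts by multiplication by `2` — a monoid on `D` in the
  sense of Def. 1.1 (ii) (the pull-back maps are injective with trivial units, and bijective);
* hence `F_Φ → F_{Φ^char}` is a Frobenioid by Prop. 1.5 (`ElemFrobenioid.isFrobenioid_toChar`);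
* the endomorphism `α = (b, 1, 1)` of the unique object, with `φ = (id, 1, 1)` and the
  automorphism `β = (b, 0, 1)`, satisfies `φ ∘ β = α ∘ φ` (zero divisors: `b^*(1) + 0 = 2 = 1 + 1`),
  so `α` is a sub-automorphism and a base-isomorphism, but `Div(α) = 1 ≠ 0`: `α` is not isometric
  and not an automorphism, and the object is `Aut^sub`-ample with `Aut`-saturated base while not
  `Aut`-saturated itself.

Consequently the three printed clauses fail for this Frobenioid as stated
(`not_subAutomorphismIsIsometryStatement`, `not_subAutomorphismIsIsoIffStatement`,
`not_autSaturatedIffStatement`); what extra hypothesis the author intends (e.g. that automorphisms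
of the base act non-dilatingly on zero divisors) is for the referee/planner to decide — this file
asserts nothing beyond the kernel-checked example. Prop. 1.12 is not cited by [IUTchI–IV] or
[EtTh] (cell census), so nothing downstream depends on it.
-/

namespace Literature.AlgebraicGeometry.Frobenioids

open CategoryTheory Opposite

namespace EndomorphismsCounterexample

/-! ### The monoid `(ℚ_{≥0}, +)`, written multiplicatively -/

/-- The divisor monoid of the example: `(ℚ_{≥0}, +)` written multiplicatively.
[cite: MochizukiFrdI2008, Prop. 1.12 p.39] -/
abbrev M : Type := Multiplicative ℚ≥0

/-- Units of `(ℚ_{≥0}, +)` are trivial. [cite: MochizukiFrdI2008, Prop. 1.12 p.39] -/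
theorem eq_one_of_isUnit_M (x : M) (hx : IsUnit x) : x = 1 := by
  obtain ⟨u, rfl⟩ := hx
  have h : u.1.toAdd + u.2.toAdd = 0 := by
    have := congrArg Multiplicative.toAdd u.3
    rwa [toAdd_mul, toAdd_one] at this
  have h1 : u.1.toAdd = 0 := le_antisymm (by rw [← h]; exact le_self_add) zero_le
  exact congrArg Multiplicative.ofAdd h1

/-- `(ℚ_{≥0}, +)` is sharp. [cite: MochizukiFrdI2008, Prop. 1.12 p.39] -/
theorem isSharp_M : IsSharp M := ⟨eq_one_of_isUnit_M⟩

/-- In `(ℚ_{≥0}, +)` associated elements are equal. [cite: MochizukiFrdI2008, Prop. 1.12 p.39] -/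
theorem eq_of_associated_M {x y : M} (h : Associated x y) : x = y := by
  obtain ⟨u, hu⟩ := h
  rw [eq_one_of_isUnit_M _ u.isUnit, mul_one] at hu
  exact hu

/-- `(ℚ_{≥0}, +)` is of characteristic type (no units). [cite: MochizukiFrdI2008, Prop. 1.12 p.39] -/
theorem isOfCharType_M : IsOfCharType M :=
  ⟨fun u _ _ => Units.ext (eq_one_of_isUnit_M _ u.isUnit)⟩

/-- `(ℚ_{≥0}, +)` is integral (cancellative). [cite: MochizukiFrdI2008, Prop. 1.12 p.39] -/
theorem isIntegral_M : IsIntegral M := isIntegral_iff_isCancelMul.mpr inferInstance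

/-- Two elements of `M^gp` with the same image agree up to a common factor (localisation).
[cite: MochizukiFrdI2008, §0 p.11] -/
private theorem gp_of_eq_of_iff {N : Type} [CommMonoid N] {a b : N} :
    Algebra.GrothendieckGroup.of a = Algebra.GrothendieckGroup.of b ↔ ∃ c : N, c * a = c * b :=
  ((Localization.monoidOf (⊤ : Submonoid N)).eq_iff_exists).trans
    ⟨fun ⟨c, h⟩ => ⟨c, h⟩, fun ⟨c, h⟩ => ⟨⟨c, Submonoid.mem_top c⟩, h⟩⟩

/-- Every element of `M^gp` is a fraction. [cite: MochizukiFrdI2008, §0 p.11] -/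
private theorem gp_exists_eq_div {N : Type} [CommMonoid N] (x : Algebra.GrothendieckGroup N) :
    ∃ a b : N, x = Algebra.GrothendieckGroup.of a / Algebra.GrothendieckGroup.of b := by
  obtain ⟨⟨a, b⟩, h⟩ := (Localization.monoidOf (⊤ : Submonoid N)).surj x
  exact ⟨a, b, eq_div_iff_mul_eq'.mpr h⟩

/-- `(ℚ_{≥0}, +)` is saturated: if `n · (a - b) ≥ 0` in `ℚ` then `a - b ≥ 0`.
[cite: MochizukiFrdI2008, Prop. 1.12 p.39] -/
theorem isSaturated_M : IsSaturated M := by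
  refine ⟨fun x n hn ⟨m₀, hx⟩ => ?_⟩
  obtain ⟨a, b, rfl⟩ := gp_exists_eq_div x
  rw [div_pow, ← map_pow, ← map_pow, eq_div_iff_mul_eq', ← map_mul, gp_of_eq_of_iff] at hx
  obtain ⟨c, hc⟩ := hx
  have hc' : m₀ * b ^ n = a ^ n := mul_left_cancel hc
  -- additively: `m₀ + n • b = n • a`, hence `b ≤ a`
  have hadd : m₀.toAdd + n • b.toAdd = n • a.toAdd := by
    have := congrArg Multiplicative.toAdd hc'
    rwa [toAdd_mul, toAdd_pow, toAdd_pow] at this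
  have hle : b.toAdd ≤ a.toAdd := by
    have h1 : n • b.toAdd ≤ n • a.toAdd := by rw [← hadd]; exact le_add_self
    rw [nsmul_eq_mul, nsmul_eq_mul] at h1
    exact le_of_mul_le_mul_left h1 (by exact_mod_cast hn)
  refine ⟨Multiplicative.ofAdd (a.toAdd - b.toAdd), ?_⟩
  rw [eq_div_iff_mul_eq', ← map_mul]
  congr 1
  apply congrArg Multiplicative.ofAdd  -- both sides as `ofAdd (toAdd _)`
  show (a.toAdd - b.toAdd) + b.toAdd = a.toAdd
  exact tsub_add_cancel_of_le hle

/-- `(ℚ_{≥0}, +)` is pre-divisorial. [cite: MochizukiFrdI2008, Prop. 1.12 p.39] -/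
theorem isPreDivisorial_M : IsPreDivisorial M :=
  { isIntegral := isIntegral_M, isSaturated := isSaturated_M, isOfCharType := isOfCharType_M }

/-! ### The base category and the monoid on it -/

/-- The base category of the example: one object with automorphism group `ℤ`.
[cite: MochizukiFrdI2008, Prop. 1.12 p.39] -/
abbrev D : Type := SingleObj (Multiplicative ℤ)

/-- Scaling `(ℚ_{≥0}, +)` by `2^k`, `k ∈ ℤ`, as a monoid endomorphism of `M`.
[cite: MochizukiFrdI2008, Prop. 1.12 p.39] -/
def scale (k : ℤ) : M →* M :=
  (AddMonoidHom.mulLeft ((2 : ℚ≥0) ^ k)).toMultiplicative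

/-- `scale k (ofAdd q) = ofAdd (2^k * q)`. [cite: MochizukiFrdI2008, Prop. 1.12 p.39] -/
@[simp] theorem toAdd_scale (k : ℤ) (x : M) : (scale k x).toAdd = (2 : ℚ≥0) ^ k * x.toAdd := rfl

/-- `scale 0 = id`. [cite: MochizukiFrdI2008, Prop. 1.12 p.39] -/
theorem scale_zero : scale 0 = MonoidHom.id M := by
  refine MonoidHom.ext fun x => ?_
  apply congrArg Multiplicative.ofAdd
  show (2 : ℚ≥0) ^ (0 : ℤ) * x.toAdd = x.toAdd
  rw [zpow_zero, one_mul]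

/-- `scale (k + l) = scale l ∘ scale k`. [cite: MochizukiFrdI2008, Prop. 1.12 p.39] -/
theorem scale_add (k l : ℤ) : scale (k + l) = (scale l).comp (scale k) := by
  refine MonoidHom.ext fun x => ?_
  apply congrArg Multiplicative.ofAdd
  show (2 : ℚ≥0) ^ (k + l) * x.toAdd = (2 : ℚ≥0) ^ l * ((2 : ℚ≥0) ^ k * x.toAdd)
  rw [zpow_add₀ (by norm_num : (2 : ℚ≥0) ≠ 0), ← mul_assoc, mul_comm ((2 : ℚ≥0) ^ l)]

/-- `scale k` is bijective (inverse `scale (-k)`). [cite: MochizukiFrdI2008, Prop. 1.12 p.39] -/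
theorem scale_bijective (k : ℤ) : Function.Bijective (scale k) := by
  have h1 : (scale (-k)).comp (scale k) = MonoidHom.id M := by rw [← scale_add, add_neg_cancel, scale_zero]
  have h2 : (scale k).comp (scale (-k)) = MonoidHom.id M := by rw [← scale_add, neg_add_cancel, scale_zero]
  refine ⟨fun x y hxy => ?_, fun y => ⟨scale (-k) y, ?_⟩⟩
  · have := congrArg (scale (-k)) hxy
    rwa [← MonoidHom.comp_apply, ← MonoidHom.comp_apply, h1] at this
  · rw [← MonoidHom.comp_apply, h2]; rfl

/-- The monoid `Φ` on `D`: `pt ↦ (ℚ_{≥0}, +)`, the arrow `k ∈ ℤ` acting by `2^k`.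
[cite: MochizukiFrdI2008, Prop. 1.12 p.39] -/
def Φex : Dᵒᵖ ⥤ CommMonCat.{0} where
  obj _ := CommMonCat.of M
  map f := CommMonCat.ofHom (scale (Multiplicative.toAdd f.unop))
  map_id X := by
    show CommMonCat.ofHom (scale (Multiplicative.toAdd (𝟙 X).unop)) = _
    rw [unop_id, SingleObj.id_as_one, toAdd_one, scale_zero]
    rfl
  map_comp f g := by
    show CommMonCat.ofHom (scale (Multiplicative.toAdd (f ≫ g).unop)) = _
    rw [unop_comp, SingleObj.comp_as_mul, toAdd_mul, scale_add]
    rfl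

/-- The pull-back maps of `Φ` are the scalings. [cite: MochizukiFrdI2008, Prop. 1.12 p.39] -/
theorem pull_Φex {X Y : D} (f : Y ⟶ X) : pull Φex f = scale (Multiplicative.toAdd f) := rfl

/-- `Φ` is a monoid on `D` (Def. 1.1 (ii)): pull-backs are characteristically injective (units are
trivial) and bijective. [cite: MochizukiFrdI2008, Prop. 1.12 p.39] -/
theorem isMonoidOn_Φex : IsMonoidOn Φex where
  isCharInjective f := by
    refine ⟨(scale_bijective _).1, fun x y hxy => ?_⟩
    obtain ⟨a, rfl⟩ := Associates.mk_surjective x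
    obtain ⟨b, rfl⟩ := Associates.mk_surjective y
    rw [associatesMap_mk, associatesMap_mk, Associates.mk_eq_mk_iff_associated] at hxy
    rw [eq_of_associated_M hxy |> (scale_bijective _).1]
  bijective_of_isFSM f _ := scale_bijective _

/-- `Φ` is objectwise pre-divisorial. [cite: MochizukiFrdI2008, Prop. 1.12 p.39] -/
theorem objectwise_isPreDivisorial_Φex : Objectwise (fun N _ => IsPreDivisorial N) Φex :=
  fun _ => isPreDivisorial_M

/-- `D` is connected (one object). [cite: MochizukiFrdI2008, Prop. 1.12 p.39] -/
theorem isGraphConnected_D : IsGraphConnected D :=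
  ⟨⟨SingleObj.star _⟩, fun X Y => by cases X; cases Y; exact Zigzag.refl _⟩

/-- `D` is totally epimorphic (a groupoid). [cite: MochizukiFrdI2008, Prop. 1.12 p.39] -/
theorem isTotallyEpimorphic_D : IsTotallyEpimorphic D := ⟨fun _ => inferInstance⟩

/-- `F_Φ → F_{Φ^char}` is a Frobenioid (Prop. 1.5). [cite: MochizukiFrdI2008, Prop. 1.12 p.39] -/
theorem isFrobenioid : PreFrobenioid.IsFrobenioid (ElemFrobenioid.toChar Φex) :=
  ElemFrobenioid.isFrobenioid_toChar isMonoidOn_Φex objectwise_isPreDivisorial_Φex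
    isGraphConnected_D isTotallyEpimorphic_D

/-! ### The example -/

/-- The unique object of `F_Φ`. [cite: MochizukiFrdI2008, Prop. 1.12 p.39] -/
abbrev A : ElemFrobenioid Φex := ElemFrobenioid.of Φex (SingleObj.star _)

/-- The generator `b = 1 ∈ ℤ` of `Aut_D(pt)`; it acts on `Φ(pt)` by multiplication by `2`.
[cite: MochizukiFrdI2008, Prop. 1.12 p.39] -/
def b : A.base ⟶ A.base := Multiplicative.ofAdd (1 : ℤ)

/-- `b^*` is multiplication by `2`: `b^*(q) = 2q`. [cite: MochizukiFrdI2008, Prop. 1.12 p.39] -/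
theorem pull_b (x : M) : pull Φex b x = Multiplicative.ofAdd (2 * x.toAdd) := by
  apply congrArg Multiplicative.ofAdd
  show (2 : ℚ≥0) ^ Multiplicative.toAdd (Multiplicative.ofAdd (1 : ℤ)) * x.toAdd = 2 * x.toAdd
  rw [toAdd_ofAdd, zpow_one]

/-- The element `1 ∈ ℚ_{≥0}` (multiplicatively written). [cite: MochizukiFrdI2008, Prop. 1.12 p.39] -/
abbrev one' : M := Multiplicative.ofAdd (1 : ℚ≥0)

/-- `1 ∈ (ℚ_{≥0}, +)` is not a unit. [cite: MochizukiFrdI2008, Prop. 1.12 p.39] -/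
theorem not_isUnit_one' : ¬ IsUnit one' := fun h => by
  have := congrArg Multiplicative.toAdd (eq_one_of_isUnit_M _ h)
  rw [toAdd_ofAdd, toAdd_one] at this
  exact one_ne_zero this

/-- The endomorphism `α = (b, 1, 1)` of the example. [cite: MochizukiFrdI2008, Prop. 1.12 p.39] -/
def α : A ⟶ A := ElemFrobenioid.homMk b one' 1

/-- The arrow `φ = (id, 1, 1)` of the example. [cite: MochizukiFrdI2008, Prop. 1.12 p.39] -/
def φ : A ⟶ A := ElemFrobenioid.homMk (𝟙 _) one' 1

/-- The automorphism `β = (b, 0, 1)` of the example. [cite: MochizukiFrdI2008, Prop. 1.12 p.39] -/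
def β : A ⟶ A := ElemFrobenioid.homMk b 1 1

/-- `β` is an isomorphism of `F_Φ`. [cite: MochizukiFrdI2008, Prop. 1.12 p.39] -/
theorem isIso_β : IsIso β := ElemFrobenioid.isIso_homMk b isUnit_one

/-- `φ ∘ β = α ∘ φ`: zero divisors `b^*(1) + 1·0 = 2 = id^*(1) + 1·1`.
[cite: MochizukiFrdI2008, Prop. 1.12 p.39] -/
theorem β_comp_φ : β ≫ φ = φ ≫ α := by
  refine ElemFrobenioid.Hom.ext ?_ ?_ rfl
  · show b ≫ 𝟙 _ = 𝟙 _ ≫ b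
    rw [Category.comp_id, Category.id_comp]
  · show ElemFrobenioid.Div (β ≫ φ) = ElemFrobenioid.Div (φ ≫ α)
    rw [ElemFrobenioid.div_comp, ElemFrobenioid.div_comp]
    simp only [β, φ, α, ElemFrobenioid.base_homMk, ElemFrobenioid.div_homMk,
      ElemFrobenioid.degFr_homMk, pull_b, pull_id, mul_one, PNat.one_coe, pow_one]
    change Multiplicative.ofAdd (2 * Multiplicative.toAdd (Multiplicative.ofAdd (1 : ℚ≥0))) =
      Multiplicative.ofAdd (1 : ℚ≥0) * Multiplicative.ofAdd (1 : ℚ≥0)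
    rw [← ofAdd_add, toAdd_ofAdd, two_mul]

/-- `α` is a sub-automorphism (witnessed by `φ`, `β`). [cite: MochizukiFrdI2008, Prop. 1.12 p.39] -/
theorem isSubAutomorphism_α : IsSubAutomorphism α :=
  haveI := isIso_β
  ⟨A, φ, asIso β, β_comp_φ⟩

/-- `α` is a base-isomorphism (its base `b` is invertible in the groupoid `D`).
[cite: MochizukiFrdI2008, Prop. 1.12 p.39] -/
theorem isBaseIso_α : PreFrobenioid.IsBaseIso (ElemFrobenioid.toChar Φex) α :=
  (inferInstance : IsIso b)

/-- `α` is not an isometry (its zero divisor `1 ∈ ℚ_{≥0}` is not a unit).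
[cite: MochizukiFrdI2008, Prop. 1.12 p.39] -/
theorem not_isIsometry_α : ¬ PreFrobenioid.IsIsometry (ElemFrobenioid.toChar Φex) α := fun h =>
  not_isUnit_one' (ElemFrobenioid.toChar_isIsometry_iff.mp h)

/-- `α` is not an isomorphism (isomorphisms of `F_Φ` have unit zero divisor).
[cite: MochizukiFrdI2008, Prop. 1.12 p.39] -/
theorem not_isIso_α : ¬ IsIso α := fun h =>
  not_isUnit_one' (@PreFrobenioid.isUnit_div_of_isIso _ _ _ _ _ (𝟭 (ElemFrobenioid Φex)) _ _ α h)

/-! ### The printed clauses of Prop. 1.12 (ii)–(iv) fail for this Frobenioid -/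

/-- The printed necessity of Prop. 1.12 (ii) fails for `F_Φ → F_{Φ^char}` at the object `A`.
[cite: MochizukiFrdI2008, Prop. 1.12(ii) p.39] -/
theorem not_subAutomorphismIsIsometryStatement :
    ¬ PreFrobenioid.SubAutomorphismIsIsometryStatement (ElemFrobenioid.toChar Φex) A :=
  fun h => not_isIsometry_α (h α isSubAutomorphism_α)

/-- The printed equivalence of Prop. 1.12 (ii) fails for `F_Φ → F_{Φ^char}` at `A`.
[cite: MochizukiFrdI2008, Prop. 1.12(ii) p.39] -/
theorem not_endoIsSubAutomorphismIffStatement :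
    ¬ PreFrobenioid.EndoIsSubAutomorphismIffStatement (ElemFrobenioid.toChar Φex) A :=
  fun h => not_isIsometry_α ((h α).mp isSubAutomorphism_α).1

/-- The printed sufficiency of Prop. 1.12 (iii) fails for `F_Φ → F_{Φ^char}` at `A`.
[cite: MochizukiFrdI2008, Prop. 1.12(iii) p.39] -/
theorem not_subAutomorphismIsIsoIffStatement :
    ¬ PreFrobenioid.SubAutomorphismIsIsoIffStatement (ElemFrobenioid.toChar Φex) A :=
  fun h => not_isIso_α ((h α isSubAutomorphism_α).mpr isBaseIso_α)

/-- `A` is `Aut^sub`-ample: every `f ∈ Aut^sub_D(pt)` lifts to the automorphism `(f, 0, 1)`.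
[cite: MochizukiFrdI2008, Prop. 1.12(iv) p.39] -/
theorem isAutSubAmple_A : PreFrobenioid.IsAutSubAmple (ElemFrobenioid.toChar Φex) A := by
  intro f _
  haveI := ElemFrobenioid.isIso_homMk (Φ := Φex) (A := A) (B := A) f isUnit_one
  exact ⟨ElemFrobenioid.homMk f 1 1, mem_autSub_of_isIso _, rfl⟩

/-- The base `pt` of `A` is `Aut`-saturated (every arrow of `D` is invertible).
[cite: MochizukiFrdI2008, Prop. 1.12(iv) p.39] -/
theorem isAutSaturatedObj_base :
    IsAutSaturatedObj (PreFrobenioid.baseObj (ElemFrobenioid.toChar Φex) A) :=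
  fun f _ => (inferInstance : IsIso f)

/-- `A` is not `Aut`-saturated (`α` is a sub-automorphism that is not an automorphism).
[cite: MochizukiFrdI2008, Prop. 1.12(iv) p.39] -/
theorem not_isAutSaturatedObj_A : ¬ IsAutSaturatedObj A :=
  fun h => not_isIso_α (h α isSubAutomorphism_α)

/-- The printed Prop. 1.12 (iv) fails for `F_Φ → F_{Φ^char}` at `A`.
[cite: MochizukiFrdI2008, Prop. 1.12(iv) p.39] -/
theorem not_autSaturatedIffStatement :
    ¬ PreFrobenioid.AutSaturatedIffStatement (ElemFrobenioid.toChar Φex) A :=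
  fun h => not_isAutSaturatedObj_A ((h isAutSubAmple_A).mpr isAutSaturatedObj_base)

/-- Summary: there is a Frobenioid with an object `A` and a base-isomorphic sub-automorphism of
`A` that is neither isometric nor an automorphism, `A` being `Aut^sub`-ample over an
`Aut`-saturated base without being `Aut`-saturated. [cite: MochizukiFrdI2008, Prop. 1.12 p.39] -/
theorem summary :
    PreFrobenioid.IsFrobenioid (ElemFrobenioid.toChar Φex) ∧ IsSubAutomorphism α ∧
      PreFrobenioid.IsBaseIso (ElemFrobenioid.toChar Φex) α ∧
      ¬ PreFrobenioid.IsIsometry (ElemFrobenioid.toChar Φex) α ∧ ¬ IsIso α ∧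
      PreFrobenioid.IsAutSubAmple (ElemFrobenioid.toChar Φex) A ∧
      IsAutSaturatedObj (PreFrobenioid.baseObj (ElemFrobenioid.toChar Φex) A) ∧
      ¬ IsAutSaturatedObj A :=
  ⟨isFrobenioid, isSubAutomorphism_α, isBaseIso_α, not_isIsometry_α, not_isIso_α, isAutSubAmple_A,
    isAutSaturatedObj_base, not_isAutSaturatedObj_A⟩

end EndomorphismsCounterexample

end Literature.AlgebraicGeometry.Frobenioids
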